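import Mathlib
import HarnessLib
import Summits.Ventures.LatticeQCDFlow.Scaling.HypercontractiveTiltedMass

/-!
# HypercontractiveComposition — `HyperContracts` under composition of layers: a layer that
# contracts zero-mass deviations in `L²(1/π)` by `λ` followed by a `HyperContracts`-layer with
# constant `ρ` gives `HyperContracts` with constant `λρ`; `m` sweeps of one `HyperContracts`-layer
# give `ρ^m` (the hypercontractive twin of "`m` sweeps ⇒ `ρ^m`" for the `χ²`-contraction)

HONEST FRAMING: exact (Metropolis-corrected) sampling algorithms for lattice gauge theory;
figures of merit are autocorrelation/cost numbers at stated couplings and volumes; no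
continuum-physics claim.

Venture `LatticeQCDFlow` (cell pub-lqcd), topic `Scaling`; FANOUT row 19 (`su2-snf`, GEN-10).
OUR WORK (elementary finite sums), nothing cited as a fact.  Vocabulary: `HyperContracts`,
`HyperContracts.sum_sq_div_le` (`Scaling/HypercontractiveDeviation`), `stepLaw_kernelComp`,
`HyperContracts.of_comp` (`Scaling/HypercontractiveTiltedMass`).  The composed kernel is written
`fun x z => Σ_y K₁ x y · K₂ y z` ("`K₁` then `K₂`").

* **`HyperContracts.comp`** — `K₁` with unit row sums and `Σ (ξK₁)²/π ≤ λ²Σ ξ²/π` on zero-mass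
  `ξ`, `K₂` with `HyperContracts K₂ π ρ` ⇒ `HyperContracts (K₁K₂) π (λρ)`
  (generalises `of_comp`, where `K₂` was fully hypercontractive, `ρ = 1`);
* **`HyperContracts.comp_hc`** — both layers `HyperContracts` (`ρ₁`, `ρ₂`), `K₁` with unit row sums
  and `π` a positive probability vector ⇒ constant `ρ₁ρ₂` (the first layer's `L²` contraction is
  at most `ρ₁`, `sum_sq_div_le`);
* `kernelPow K m` (the `m`-fold composition, `kernelPow K 0 = ` the identity kernel) with
  `stepLaw_kernelPow_zero/succ`, `sum_kernelPow`, and **`HyperContracts.kernelPow`** — for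
  `m ≥ 1`, `HyperContracts (K^m) π ρ^m` given `HyperContracts K π ρ`, unit row sums, `π` a positive
  probability vector.

NOT CLAIMED: anything about `m = 0` (the identity layer is not hypercontractive).
-/

namespace Summit.Ventures.LatticeQCDFlow.Scaling

open Finset
open Literature.Probability.MarkovChains (stepLaw IsStationary)

variable {X : Type*} [Fintype X] [DecidableEq X]

omit [DecidableEq X] in
/-- Unit row sums are preserved by zero-mass inputs: `Σ_y (ξK₁)(y) = Σ_x ξ(x)`. -/
theorem sum_stepLaw_eq_sum {K : X → X → ℝ} (hrow : ∀ x, ∑ y, K x y = 1) (ξ : X → ℝ) :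
    ∑ y, stepLaw K ξ y = ∑ x, ξ x := by
  unfold stepLaw
  rw [sum_comm]
  exact sum_congr rfl fun x _ => by rw [← mul_sum, hrow x, mul_one]

omit [DecidableEq X] in
/-- **COMPOSITION.**  An `L²(1/π)`-contraction by `λ` on zero-mass inputs (unit row sums) followed
by a `HyperContracts`-layer with constant `ρ` is a `HyperContracts`-layer with constant `λρ`
(no sign conditions are needed: only even powers of `λ`, `ρ` enter). -/
theorem HyperContracts.comp {K₁ K₂ : X → X → ℝ} {π : X → ℝ} {lam ρ : ℝ} (hπ : ∀ x, 0 < π x)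
    (hrow₁ : ∀ x, ∑ y, K₁ x y = 1)
    (hK₁ : ∀ ξ : X → ℝ, ∑ x, ξ x = 0 →
      ∑ y, stepLaw K₁ ξ y ^ 2 / π y ≤ lam ^ 2 * ∑ x, ξ x ^ 2 / π x)
    (hK₂ : HyperContracts K₂ π ρ) :
    HyperContracts (fun x z => ∑ y, K₁ x y * K₂ y z) π (lam * ρ) := by
  intro ξ hξ
  simp_rw [stepLaw_kernelComp K₁ K₂ ξ]
  have hξ₁ : ∑ y, stepLaw K₁ ξ y = 0 := by rw [sum_stepLaw_eq_sum hrow₁, hξ]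
  refine (hK₂ (stepLaw K₁ ξ) hξ₁).trans ?_
  have h0 : 0 ≤ ∑ y, stepLaw K₁ ξ y ^ 2 / π y :=
    sum_nonneg fun y _ => div_nonneg (sq_nonneg _) (hπ y).le
  calc ρ ^ 4 * (∑ y, stepLaw K₁ ξ y ^ 2 / π y) ^ 2
      ≤ ρ ^ 4 * (lam ^ 2 * ∑ x, ξ x ^ 2 / π x) ^ 2 :=
        mul_le_mul_of_nonneg_left (pow_le_pow_left₀ h0 (hK₁ ξ hξ) 2) (by positivity)
    _ = (lam * ρ) ^ 4 * (∑ x, ξ x ^ 2 / π x) ^ 2 := by ring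

omit [DecidableEq X] in
/-- **Two `HyperContracts`-layers in succession**: constants multiply (`π` a positive probability
vector, first layer with unit row sums). -/
theorem HyperContracts.comp_hc {K₁ K₂ : X → X → ℝ} {π : X → ℝ} {ρ₁ ρ₂ : ℝ} (hπ : ∀ x, 0 < π x)
    (hπ1 : ∑ x, π x = 1) (hrow₁ : ∀ x, ∑ y, K₁ x y = 1)
    (hK₁ : HyperContracts K₁ π ρ₁) (hK₂ : HyperContracts K₂ π ρ₂) :
    HyperContracts (fun x z => ∑ y, K₁ x y * K₂ y z) π (ρ₁ * ρ₂) :=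
  HyperContracts.comp hπ hrow₁ (fun _ hξ => hK₁.sum_sq_div_le hπ hπ1 hξ) hK₂

/-! ## Powers of one layer -/

/-- The `m`-fold composition of a kernel (`kernelPow K 0` = the identity kernel,
`kernelPow K (m+1) = (kernelPow K m)` then `K`). -/
def kernelPow (K : X → X → ℝ) : ℕ → X → X → ℝ
  | 0 => fun x z => if x = z then 1 else 0
  | m + 1 => fun x z => ∑ y, kernelPow K m x y * K y z

/-- `ξ(K^0) = ξ`. -/
theorem stepLaw_kernelPow_zero (K : X → X → ℝ) (ξ : X → ℝ) : stepLaw (kernelPow K 0) ξ = ξ := by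
  funext z
  unfold stepLaw kernelPow
  simp [Finset.sum_ite_eq', Finset.mem_univ]

/-- `ξ(K^{m+1}) = (ξ K^m) K`. -/
theorem stepLaw_kernelPow_succ (K : X → X → ℝ) (m : ℕ) (ξ : X → ℝ) :
    stepLaw (kernelPow K (m + 1)) ξ = stepLaw K (stepLaw (kernelPow K m) ξ) := by
  funext z
  exact stepLaw_kernelComp (kernelPow K m) K ξ z

/-- The powers of a unit-row-sum kernel have unit row sums. -/
theorem sum_kernelPow {K : X → X → ℝ} (hrow : ∀ x, ∑ y, K x y = 1) :
    ∀ m x, ∑ z, kernelPow K m x z = 1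
  | 0, x => by simp [kernelPow, Finset.sum_ite_eq, Finset.mem_univ]
  | m + 1, x => by
    unfold kernelPow
    rw [sum_comm]
    simp_rw [← mul_sum, hrow, mul_one]
    exact sum_kernelPow hrow m x

/-- **`m ≥ 1` sweeps of a `HyperContracts`-layer form a `HyperContracts`-layer with constant `ρ^m`**
(`π` a positive probability vector, unit row sums, `ρ ≥ 0`). -/
theorem HyperContracts.kernelPow {K : X → X → ℝ} {π : X → ℝ} {ρ : ℝ} (hπ : ∀ x, 0 < π x)
    (hπ1 : ∑ x, π x = 1) (hrow : ∀ x, ∑ y, K x y = 1) (hK : HyperContracts K π ρ) :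
    ∀ m, HyperContracts (kernelPow K (m + 1)) π (ρ ^ (m + 1))
  | 0 => by
    intro ξ hξ
    have h := hK ξ hξ
    simp_rw [stepLaw_kernelPow_succ, stepLaw_kernelPow_zero]
    simpa using h
  | m + 1 => by
    have ih := HyperContracts.kernelPow hπ hπ1 hrow hK m
    have h := HyperContracts.comp_hc hπ hπ1 (sum_kernelPow hrow (m + 1)) ih hK
    rw [pow_succ]
    exact h

end Summit.Ventures.LatticeQCDFlow.Scaling
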